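import Summits.Ventures.CertifiedManyBodySolver.Observables.MeanFieldClassExclusionObjectE
import Summits.Ventures.CertifiedManyBodySolver.Certificates.HubbardSquare_n1o2_upper_qfp_L2_row498
import Literature.MathematicalPhysics.QuantumLattice.HubbardFermiSeaTangentRowsLscoColumns
import Literature.MathematicalPhysics.QuantumLattice.HubbardFermiSeaTangentRowsLow
import HarnessLib

/-!
# Ventures/CertifiedManyBodySolver — Observables/MeanFieldClassExclusionLaOverdoped.lean

HONEST FRAMING: first certified bounds; not a superconductivity verdict; every number certified or labelled float.
A competing-order EXCLUSION removes a named class of candidate ground states; it never says which order is present;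
no phase sentence follows.

Cell `hubbard-tc` (MO-S3, D-0096), seat `hubbard-tc-mod-3` (G3), `prover-hubbard-tc-mod-3-g4-0`. The OVERDOPED columns of the
La₂₋ₓSrₓCuO₄ S1 box of record, OBJECT E (`t–t′` effective set): x = 0.30 (column #50: `U/t_eff ∈ [7.9, 16.7]`,
`t′/t_eff ∈ [−0.23, −0.13]`, `n ∈ [0.68, 0.72]`) — the one La column that `MeanFieldClassExclusionLaColumns.lean` left to the
cert-num engine — and a re-threshold of x = 0.22 (M17: `[7.9, 14.7] × [−0.30, −0.20] × [0.76, 0.80]`, `laCol_x022_docc_lt_of`: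
`U ≥ 7.9`). For every torus limit `ω` of unit `(rectN n L, S^z = 0)`-sector ground states of `hubbardTorusTT' L 1 t′ U`,

  `Re ω(n_{0↑} n_{0↓}) < (n/2)²`   (no ground state is a non-magnetic Hartree–Fock / singlet-BCS state, any gap — Wick:
                                     `docc ≥ (n/2)²`, Bach–Lieb–Solovej 1994 §2),

on  x = 0.30: `t′ ∈ [−1/4, 0]`, `n ∈ [17/25, 18/25]`, EVERY `U ≥ 15/2` (`laE_x030_docc_lt_of`, cond. #498 ∧ #472) — so on the
    WHOLE box #50 and beyond;
    x = 0.22: `t′ ∈ [−3/10, −1/5]`, `n ∈ [19/25, 4/5]`, EVERY `U ≥ 7` (`laE_x022_docc_lt_of`, cond. #498 ∧ #445).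

THE NEW INPUT is the CERTIFIED quarter-filling cap #498, `e(1, 0, 8, 1/2) ≤ −0.9916692317` (sr-mbsolver, plaquette-dressed
quasi-free TL upper; claim node `cert_r498_qfp_U8_n1o2_tp0_upper`): transported in `t′` by the decimal kinematic law
`1.6212|Δt′|` (`energyDensityTT'_tPrime_transport_ge_decimal`) and joined by a DENSITY CHORD (convexity of `n ↦ e`,
`energyDensityTT'_le_density_chord`) to the half-filling cap #472 (`t′`-even + concave: every `t′`, `objE_halfFilling_cap8`) or to the
`n = 7/8` cap #445 at `t′ = −1/4`, it caps `e(1, t′, 8, n)` at `n ≈ 0.7` some `0.09–0.15` below the vacuum chords of the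
`n ∈ {3/4, 7/8, 1}` caps that the earlier files (and the seat's cert-num engine `box_words.py`) had available — enough to pass the
`U = 8` test `u₈ − ℓ < 8(n/2)²` with margin, after which the `U`-tail is free (`doccN_lt_of_cap8_threshold`: monotone below `8`,
Hartree–Fock Lipschitz slope `(n/2)²` above). Floors: the tangent Fermi-sea rows at `n₀ = 7/10` / `39/50`
(`HubbardFermiSeaTangentRowsLscoColumns`, hubbard-box-eng-1; `HubbardFermiSeaTangentRowsLow`, this seat), read between columns by
concavity in `t′` (`objE_floor_between`). The bilinear `(n, t′)` term of each chord cap is linearised at the band edge (sign of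
`t′ ≤ 0` fixed), the class constant `(n/2)²` is read above its tangent at the lower band edge, and every leaf is ONE linear
inequality (`linarith`); smallest exact margins `+0.031` (x = 0.30, `U₁ = 15/2`) and `+0.131` (x = 0.22, `U₁ = 7`)
(seat designer `hubbard-tc-mod-3/g4-replay/design2.py`, exact rationals).
WHAT THIS IS NOT: a statement about stripes, d-wave order or T_c; the saturated-FM class (which is NOT excluded at these
fillings: the polarised Fermi sea lies below every certified cap there); tight; a phase word — the cell word stays «undetermined».

References: T. Koma, H. Tasaki, J. Stat. Phys. 76 (1994) 745, §1 [KomaTasaki1994]; V. Bach, E. H. Lieb, J. P. Solovej,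
J. Stat. Phys. 76 (1994) 3, eq. (2c.36) [BachLiebSolovej1994]; E. H. Lieb, M. Loss, Duke Math. J. 71 (1993) 337, §8 Thm 8.2
[LiebLoss1993]; R. B. Israel, Convexity in the Theory of Lattice Gases (1979), Thm I.3.4 [Israel1979]; D. Ruelle,
Statistical Mechanics (1969) §3.3 [Ruelle1969].
-/

noncomputable section

namespace Summit.Ventures.CertifiedManyBodySolver.Observables

open Literature.MathematicalPhysics.QuantumLattice
open Literature.MathematicalPhysics.QuantumLattice.ThermodynamicLimit
open Summit.Ventures.CertifiedManyBodySolver.Certificates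
open Matrix HubbardWave0 Literature.Probability.LatticeModels Filter Topology
open scoped ComplexOrder BigOperators


/-! ### §1 Devices: the quarter-filling cap and its density chords -/

/-- The CERTIFIED #498 cap as a decimal: `e(1, 0, 8, 1/2) ≤ −0.9916692317` (claim node `cert_r498_qfp_U8_n1o2_tp0_upper`,
`m3grid_U8_n1o2_tp0_upper_r498_of`). [cite: Ruelle1969, §3.3] -/
theorem laE_quarter_cap_decimal_of (h498 : cert_r498_qfp_U8_n1o2_tp0_upper) :
    energyDensityTT' 1 0 8 (1 / 2) ≤ -0.9916692317 := by
  have h := m3grid_U8_n1o2_tp0_upper_r498_of h498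
  refine h.trans ?_
  push_cast
  norm_num

/-- **The quarter-filling cap transported in `t′`** (`s ≤ 0`): `e(1, 0, 8, 1/2) ≤ H` gives `e(1, s, 8, 1/2) ≤ H − 1.6212·s`
(decimal kinematic law, `1.6212 > 16/π²`). [cite: Israel1979, Thm. I.3.4] [cite: LiebLoss1993, §8, Theorem 8.2] -/
theorem laE_quarter_cap_at {s H : ℝ} (hH : energyDensityTT' 1 0 8 (1 / 2) ≤ H) (hs : s ≤ 0) :
    energyDensityTT' 1 s 8 (1 / 2) ≤ H - 1.6212 * s := by
  have h := energyDensityTT'_tPrime_transport_ge_decimal 1 (by norm_num : (0 : ℝ) ≤ 8)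
    (by norm_num : (0 : ℝ) ≤ 1 / 2) (by norm_num : (1 / 2 : ℝ) < 2) s 0
  rw [zero_sub, abs_neg, abs_of_nonpos hs] at h
  linarith

/-- **Cap by the density chord quarter → half filling** (route «½–1»): caps `e(1, 0, 8, 1/2) ≤ H` and `e(1, s, 8, 1) ≤ C` give,
for `s ≤ 0` and `n₁ ≤ n`, `1/2 < n < 1`:
`e(1, s, 8, n) ≤ 2(1 − n)H + (2n − 1)C − 2(1 − n₁)·1.6212·s` — the chord `[(1 − n)(H − 1.6212 s) + (n − ½)C]/(½)` (convexity in
the density) with the bilinear term `−2(1 − n)·1.6212·s ≤ −2(1 − n₁)·1.6212·s` (`−s ≥ 0`, `1 − n ≤ 1 − n₁`).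
[cite: Ruelle1969, §3.3] [cite: Israel1979, Thm. I.3.4] -/
theorem laE_cap_quarterOne {s n n₁ H C : ℝ} (hH : energyDensityTT' 1 0 8 (1 / 2) ≤ H)
    (hC : energyDensityTT' 1 s 8 1 ≤ C) (hs : s ≤ 0) (hn₁ : n₁ ≤ n) (h1 : 1 / 2 < n) (h2 : n < 1) :
    energyDensityTT' 1 s 8 n ≤ 2 * (1 - n) * H + (2 * n - 1) * C - 2 * (1 - n₁) * 1.6212 * s := by
  have hHs := laE_quarter_cap_at hH hs
  have hd := energyDensityTT'_le_density_chord 1 s (by norm_num : (0 : ℝ) ≤ 8) (n₁ := 1 / 2) (n := n) (n₂ := 1)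
    (by norm_num) h1 h2 (by norm_num) hHs hC
  have e1 : ((1 - n) * (H - 1.6212 * s) + (n - 1 / 2) * C) / (1 - 1 / 2) =
      2 * (1 - n) * H + (2 * n - 1) * C - 2 * (1 - n) * 1.6212 * s := by ring
  rw [e1] at hd
  have h3 : -(2 * (1 - n) * 1.6212 * s) ≤ -(2 * (1 - n₁) * 1.6212 * s) := by
    nlinarith [mul_nonneg (sub_nonneg.2 hn₁) (neg_nonneg.2 hs)]
  linarith

/-- **Cap by the density chord quarter → 7/8, shallow side** (route «½–⅞», `−1/4 ≤ s ≤ 0`): caps `e(1, 0, 8, 1/2) ≤ H` and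
`e(1, −1/4, 8, 7/8) ≤ R` give, for `n₁ ≤ n`, `1/2 < n < 7/8`:
`e(1, s, 8, n) ≤ (8/3)[(7/8 − n)H + (n − ½)(R + 1.6212/4)] + (8/3)·1.6212·(2n₁ − 11/8)·s` — both anchors transported to `s`
(`H − 1.6212 s`, `R + 1.6212 (s + 1/4)`), the chord at `n`, and the bilinear term `(16/3)·1.6212·n·s ≤ (16/3)·1.6212·n₁·s`
(`s ≤ 0`, `n ≥ n₁`). [cite: Ruelle1969, §3.3] [cite: Israel1979, Thm. I.3.4] -/
theorem laE_cap_quarterStrip {s n n₁ H R : ℝ} (hH : energyDensityTT' 1 0 8 (1 / 2) ≤ H)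
    (hR : energyDensityTT' 1 (-1 / 4) 8 (7 / 8) ≤ R) (hs1 : -1 / 4 ≤ s) (hs : s ≤ 0) (hn₁ : n₁ ≤ n)
    (h1 : 1 / 2 < n) (h2 : n < 7 / 8) :
    energyDensityTT' 1 s 8 n ≤
      8 / 3 * ((7 / 8 - n) * H + (n - 1 / 2) * (R + 1.6212 / 4)) + 8 / 3 * 1.6212 * (2 * n₁ - 11 / 8) * s := by
  have hHs := laE_quarter_cap_at hH hs
  have hRs : energyDensityTT' 1 s 8 (7 / 8) ≤ R + 1.6212 * (s + 1 / 4) := by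
    have h := energyDensityTT'_tPrime_transport_ge_decimal 1 (by norm_num : (0 : ℝ) ≤ 8)
      (by norm_num : (0 : ℝ) ≤ 7 / 8) (by norm_num : (7 / 8 : ℝ) < 2) s (-1 / 4)
    rw [show (-1 / 4 : ℝ) - s = -(s + 1 / 4) by ring, abs_neg, abs_of_nonneg (by linarith : 0 ≤ s + 1 / 4)] at h
    linarith
  have hd := energyDensityTT'_le_density_chord 1 s (by norm_num : (0 : ℝ) ≤ 8) (n₁ := 1 / 2) (n := n) (n₂ := 7 / 8)
    (by norm_num) h1 h2 (by norm_num) hHs hRs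
  have e1 : ((7 / 8 - n) * (H - 1.6212 * s) + (n - 1 / 2) * (R + 1.6212 * (s + 1 / 4))) / (7 / 8 - 1 / 2) =
      8 / 3 * ((7 / 8 - n) * H + (n - 1 / 2) * (R + 1.6212 / 4)) + 8 / 3 * 1.6212 * (2 * n - 11 / 8) * s := by ring
  rw [e1] at hd
  have h3 : 8 / 3 * 1.6212 * (2 * n - 11 / 8) * s ≤ 8 / 3 * 1.6212 * (2 * n₁ - 11 / 8) * s := by
    nlinarith [mul_nonneg (sub_nonneg.2 hn₁) (neg_nonneg.2 hs)]
  linarith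

/-- **Cap by the density chord quarter → 7/8, deep side** (route «½–⅞», `s ≤ −1/4`): caps `e(1, 0, 8, 1/2) ≤ H` and
`e(1, −1/4, 8, 7/8) ≤ R` give, for `1/2 < n < 7/8`:
`e(1, s, 8, n) ≤ (8/3)[(7/8 − n)H + (n − ½)(R − 1.6212/4)] − 1.6212·s` — both anchors transported to `s` with the same slope
(`H − 1.6212 s`, `R + 1.6212(−1/4 − s)`), so the chord is affine. [cite: Ruelle1969, §3.3] [cite: Israel1979, Thm. I.3.4] -/
theorem laE_cap_quarterStripDeep {s n H R : ℝ} (hH : energyDensityTT' 1 0 8 (1 / 2) ≤ H)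
    (hR : energyDensityTT' 1 (-1 / 4) 8 (7 / 8) ≤ R) (hs : s ≤ -1 / 4) (h1 : 1 / 2 < n) (h2 : n < 7 / 8) :
    energyDensityTT' 1 s 8 n ≤ 8 / 3 * ((7 / 8 - n) * H + (n - 1 / 2) * (R - 1.6212 / 4)) - 1.6212 * s := by
  have hHs := laE_quarter_cap_at (s := s) hH (by linarith)
  have hRs : energyDensityTT' 1 s 8 (7 / 8) ≤ R + 1.6212 * (-1 / 4 - s) := by
    have h := energyDensityTT'_tPrime_transport_ge_decimal 1 (by norm_num : (0 : ℝ) ≤ 8)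
      (by norm_num : (0 : ℝ) ≤ 7 / 8) (by norm_num : (7 / 8 : ℝ) < 2) s (-1 / 4)
    rw [abs_of_nonneg (by linarith : 0 ≤ (-1 / 4 : ℝ) - s)] at h
    linarith
  have hd := energyDensityTT'_le_density_chord 1 s (by norm_num : (0 : ℝ) ≤ 8) (n₁ := 1 / 2) (n := n) (n₂ := 7 / 8)
    (by norm_num) h1 h2 (by norm_num) hHs hRs
  have e1 : ((7 / 8 - n) * (H - 1.6212 * s) + (n - 1 / 2) * (R + 1.6212 * (-1 / 4 - s))) / (7 / 8 - 1 / 2) =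
      8 / 3 * ((7 / 8 - n) * H + (n - 1 / 2) * (R - 1.6212 / 4)) - 1.6212 * s := by ring
  rw [e1] at hd
  exact hd


/-! ### §2 The words -/

/-- **La₂₋ₓSrₓCuO₄ x = 0.30 (column #50 of the S1 box of record, OBJECT E `[7.9, 16.7] × [−0.23, −0.13] × [0.68, 0.72]`) —
MF/BCS class excluded on the WHOLE box.** Assume the claim nodes of CERTIFIED #498 and #472. For every `t′ ∈ [−1/4, 0]`, EVERY
`U ≥ 15/2` and `n ∈ [17/25, 18/25]`, every GS torus limit has `Re ω(n_{0↑}n_{0↓}) < (n/2)²`. Cap = route «½–1»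
(`laE_cap_quarterOne` with the half-filling cap #472 at every `t′`); floor = tangent rows at `n₀ = 7/10` on the columns
`−1/4, −1/5, −3/20, −1/10, 0` read between columns by concavity; four `t′`-pieces × two floor branches; smallest linear margin `+0.031`
(at `t′ = −1/4`, `n = 17/25`). [cite: KomaTasaki1994, §1] [cite: BachLiebSolovej1994, eq. (2c.36)] [cite: LiebLoss1993, §8, Theorem 8.2] -/
theorem laE_x030_docc_lt_of (h498 : cert_r498_qfp_U8_n1o2_tp0_upper) (h472 : cert_r472_pb2_tl_upper_n1_U8)
    {t' U n : ℝ} (ht1 : -1 / 4 ≤ t') (ht0 : t' ≤ 0) (hU : 15 / 2 ≤ U)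
    (hn1 : 17 / 25 ≤ n) (hn2 : n ≤ 18 / 25) :
    ∀ (ω : InfVolFermionState 2) (Ls : ℕ → ℕ) (ψ : ∀ L, Fock (Orb (FermionTorus 2 L))),
      Tendsto Ls atTop atTop →
      (∀ j, IsGroundStateInSector (hubbardTorusTT' (Ls j) 1 t' U) (rectN n (Ls j)) 0 (ψ (Ls j))) →
      (∀ j, star (ψ (Ls j)) ⬝ᵥ ψ (Ls j) = 1) → ω.IsTorusLimitOf ψ Ls →
      (ω.expect ({0} : Finset (Site 2))
        (nAt 0 (Finset.mem_singleton_self 0) 0 * nAt 0 (Finset.mem_singleton_self 0) 1)).re < (n / 2) ^ 2 := by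
  have hn0 : (0 : ℝ) ≤ n := by linarith
  have hn2' : n < 2 := by linarith
  -- the class constant `(n/2)²` above its tangent at `n = 17/25`, scaled by the threshold `U₁ = 15/2`
  have hsq : (-289 / 2500 : ℝ) + 17 / 50 * n ≤ (n / 2) ^ 2 := by nlinarith [sq_nonneg (n - 17 / 25)]
  have hsqU : ((-289 / 2500 : ℝ) + 17 / 50 * n) * (15 / 2) ≤ (n / 2) ^ 2 * (15 / 2) :=
    mul_le_mul_of_nonneg_right hsq (by norm_num)
  have hH := laE_quarter_cap_decimal_of h498
  have hC8 := objE_halfFilling_cap8 h472 t'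
  have hcap := laE_cap_quarterOne hH hC8 ht0 hn1 (by linarith) (by linarith)
  have ra := fermiSeaTangentRow_tPrime_neg_one_div_four_at_seven_div_ten (U := 0) le_rfl hn0 hn2'
  have rb := fermiSeaTangentRow_tPrime_neg_one_div_five_at_seven_div_ten (U := 0) le_rfl hn0 hn2'
  have rc := fermiSeaTangentRow_tPrime_neg_three_div_twenty_at_seven_div_ten (U := 0) le_rfl hn0 hn2'
  have rd := fermiSeaTangentRow_tPrime_neg_one_div_ten_at_seven_div_ten (U := 0) le_rfl hn0 hn2'
  have re := fermiSeaTangentRow_tPrime_zero_at_seven_div_ten (U := 0) le_rfl hn0 hn2'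
  rcases le_or_gt t' (-1 / 5) with hp | hp
  · -- piece `t' ∈ [-1/4, -1/5]`
    have hfl := objE_floor_between hn0 hn2' (by norm_num : (-1 / 4 : ℝ) ≤ -1 / 5) ra rb ht1 hp
    exact doccN_lt_of_cap8_threshold (U₁ := 15 / 2) (by norm_num) (by norm_num) hU hn0 hn2' hcap hfl
      (sub_min_lt_of (by linarith) (by linarith))
  rcases le_or_gt t' (-3 / 20) with hq | hq
  · -- piece `t' ∈ (-1/5, -3/20]`
    have hfl := objE_floor_between hn0 hn2' (by norm_num : (-1 / 5 : ℝ) ≤ -3 / 20) rb rc hp.le hq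
    exact doccN_lt_of_cap8_threshold (U₁ := 15 / 2) (by norm_num) (by norm_num) hU hn0 hn2' hcap hfl
      (sub_min_lt_of (by linarith) (by linarith))
  rcases le_or_gt t' (-1 / 10) with hr | hr
  · -- piece `t' ∈ (-3/20, -1/10]`
    have hfl := objE_floor_between hn0 hn2' (by norm_num : (-3 / 20 : ℝ) ≤ -1 / 10) rc rd hq.le hr
    exact doccN_lt_of_cap8_threshold (U₁ := 15 / 2) (by norm_num) (by norm_num) hU hn0 hn2' hcap hfl
      (sub_min_lt_of (by linarith) (by linarith))
  · -- piece `t' ∈ (-1/10, 0]`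
    have hfl := objE_floor_between hn0 hn2' (by norm_num : (-1 / 10 : ℝ) ≤ 0) rd re hr.le ht0
    exact doccN_lt_of_cap8_threshold (U₁ := 15 / 2) (by norm_num) (by norm_num) hU hn0 hn2' hcap hfl
      (sub_min_lt_of (by linarith) (by linarith))

/-- **La₂₋ₓSrₓCuO₄ x = 0.22 (VSET M17, OBJECT E `[7.9, 14.7] × [−0.30, −0.20] × [0.76, 0.80]`) — MF/BCS class excluded
on the WHOLE box, from `U = 7`** (re-threshold of `laCol_x022_docc_lt_of`, which starts at `7.9`). Assume the claim nodes of
CERTIFIED #498 and #445. For every `t′ ∈ [−3/10, −1/5]`, EVERY `U ≥ 7` and `n ∈ [19/25, 4/5]`, every GS torus limit has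
`Re ω(n_{0↑}n_{0↓}) < (n/2)²`. Cap = route «½–⅞» (`laE_cap_quarterStripDeep` on `[−3/10, −1/4]`, `laE_cap_quarterStrip` on
`[−1/4, −1/5]`); floor = tangent rows at `n₀ = 39/50` on the columns `−3/10, −1/4, −1/5`; smallest linear margin `+0.131`.
[cite: KomaTasaki1994, §1] [cite: BachLiebSolovej1994, eq. (2c.36)] [cite: LiebLoss1993, §8, Theorem 8.2] -/
theorem laE_x022_docc_lt_of (h498 : cert_r498_qfp_U8_n1o2_tp0_upper) (h445 : cert_dbt329pair_allk)
    {t' U n : ℝ} (ht1 : -3 / 10 ≤ t') (ht0 : t' ≤ -1 / 5) (hU : 7 ≤ U)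
    (hn1 : 19 / 25 ≤ n) (hn2 : n ≤ 4 / 5) :
    ∀ (ω : InfVolFermionState 2) (Ls : ℕ → ℕ) (ψ : ∀ L, Fock (Orb (FermionTorus 2 L))),
      Tendsto Ls atTop atTop →
      (∀ j, IsGroundStateInSector (hubbardTorusTT' (Ls j) 1 t' U) (rectN n (Ls j)) 0 (ψ (Ls j))) →
      (∀ j, star (ψ (Ls j)) ⬝ᵥ ψ (Ls j) = 1) → ω.IsTorusLimitOf ψ Ls →
      (ω.expect ({0} : Finset (Site 2))
        (nAt 0 (Finset.mem_singleton_self 0) 0 * nAt 0 (Finset.mem_singleton_self 0) 1)).re < (n / 2) ^ 2 := by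
  have hn0 : (0 : ℝ) ≤ n := by linarith
  have hn2' : n < 2 := by linarith
  -- the class constant `(n/2)²` above its tangent at `n = 19/25`, scaled by the threshold `U₁ = 7`
  have hsq : (-361 / 2500 : ℝ) + 19 / 50 * n ≤ (n / 2) ^ 2 := by nlinarith [sq_nonneg (n - 19 / 25)]
  have hsqU : ((-361 / 2500 : ℝ) + 19 / 50 * n) * 7 ≤ (n / 2) ^ 2 * 7 :=
    mul_le_mul_of_nonneg_right hsq (by norm_num)
  have hH := laE_quarter_cap_decimal_of h498
  have hR := m3_tpm1o4_cap_decimal_of h445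
  have ra := fermiSeaTangentRow_tPrime_neg_three_div_ten_at_thirtynine_div_fifty (U := 0) le_rfl hn0 hn2'
  have rb := fermiSeaTangentRow_tPrime_neg_one_div_four_at_thirtynine_div_fifty (U := 0) le_rfl hn0 hn2'
  have rc := fermiSeaTangentRow_tPrime_neg_one_div_five_at_thirtynine_div_fifty (U := 0) le_rfl hn0 hn2'
  rcases le_or_gt t' (-1 / 4) with hp | hp
  · -- piece `t' ∈ [-3/10, -1/4]`: deep chord cap
    have hcap := laE_cap_quarterStripDeep (n := n) hH hR hp (by linarith) (by linarith)
    have hfl := objE_floor_between hn0 hn2' (by norm_num : (-3 / 10 : ℝ) ≤ -1 / 4) ra rb ht1 hp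
    exact doccN_lt_of_cap8_threshold (U₁ := 7) (by norm_num) (by norm_num) hU hn0 hn2' hcap hfl
      (sub_min_lt_of (by linarith) (by linarith))
  · -- piece `t' ∈ (-1/4, -1/5]`: shallow chord cap, bilinear term linearised at `n₁ = 19/25`
    have hcap := laE_cap_quarterStrip hH hR hp.le (by linarith) hn1 (by linarith) (by linarith)
    have hfl := objE_floor_between hn0 hn2' (by norm_num : (-1 / 4 : ℝ) ≤ -1 / 5) rb rc hp.le ht0
    exact doccN_lt_of_cap8_threshold (U₁ := 7) (by norm_num) (by norm_num) hU hn0 hn2' hcap hfl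
      (sub_min_lt_of (by linarith) (by linarith))

end Summit.Ventures.CertifiedManyBodySolver.Observables

end
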